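import Summits.QuantumFields.YangMills.Theorems.SwapVirialDeficitSectorLaplaceEndHubHubCot
import Summits.QuantumFields.YangMills.Theorems.SwapVirialDeficitSectorLaplaceBTubeCapFarFloor
import Summits.QuantumFields.YangMills.Theorems.SwapVirialDeficitSectorLaplaceBulkMassFloor
import HarnessLib

/-!
# THE END CORE SPLITS INTO A GAUSSIAN HALF AND A HUB-SHELL TAIL — `stub_core_end` of skeleton ➎, assembly side
# (free-hands support of ⟨stmt-QuantumFields-24197⟩ `SwapVirialDeficit.SwapGluedStiffness`; LEAD g99 referee note 2026-08-31 22:00Z in Lean)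

In the letters `(δ, η)` of ✓`setLIntegral_endCore_eq_hubCot` the end core of skeleton ➎ v9 is `{end window} ∖ RgCap`,
`{end window} = {4δ²/(1+δ²)² < τ ≤ (1+δ²)⁻¹}`, `RgCap = {end window ∧ |δ| < τ√(1+δ²)} ∩ {τ ≤ |u|} ∩ {|x₀| ≤ X₁√(1+|u|²)}` (`u = (η_x1, η_x2)`, `x₀ = η_x0`).
§1: on the end window `δ² < 1/3`, `δ² < τ(1+δ²)²/4 ≤ 4τ/9` and `τ ≤ 1` (`endWindow_sq_lt_third`, `endWindow_sq_lt`, `endWindow_sq_le`, `endWindow_tau_le_one`).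
§2 ★ `endCore_letters_subset`: `{end window} ∖ RgCap ⊆ G ∪ T` with the GAUSSIAN HALF `G = {end window} ∩ {|u|² ≤ 1 + x₀²}` (parts (i) `|u| < τ` and (ii) cap violated,
`X₁ ≥ 1`) and the HUB SHELL `T = {end window ∧ τ√(1+δ²) ≤ |δ|} ∩ {τ ≤ |u|} ∩ {cap}` (part (iii)); both measurable.
§3 ★ `endCore_partIII_floor`: on `T`, for EVERY sign pattern, `c_end := τ⁴/((1+τ²)(1+X₁²)²·15000(1+|Fol L|)L⁶) ≤ F̂(hubAt δ 1, ε, η)` (w3 g67's ✓`bTubeCap_letter_floor`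
with `δ² ≥ τ²(1+δ²) ≥ τ²`) — a CONSTANT floor, so the shell is a threshold tail.
§4 `muB_univ_le` ∕ `muB_univ_le_exp`: `μ_B(univ) ≤ π·∫ρ ≤ π·e^{|log(coneConst³/64)| + 18L⁴}` (✓`totalMass_le_exp`).
§5 ★★ `lintegral_endCore_le_gaussHalf_add_tail` ∕ ★★ `setIntegral_endCore_le_gaussHalf_add_tail` ∕ ★★ `setIntegral_endCore_chart_le_gaussHalf_add_tail`:
`∫_{{end window}∖RgCap} e^{−bF̂} dμ_B ≤ ∫_G e^{−bF̂} dμ_B + e^{−b·c_end}·π·e^{|log(coneConst³/64)|+18L⁴}` (`b ≥ 0`), and the same read back on `chartMeasure L` over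
`(EndHub τ ×ˢ univ) ∖ BTubeCap L τ 1` (factor `coneConst·π`, ✓`setIntegral_endCore_exp_eq_hubCot`).  So the assembler's end core = the Gaussian-half integral
(leader side w3 g67 U1∕S1, follower side w2 g60 ✓`follower_laplace_ceiling`) + an explicit threshold tail (✓`exp_absorb` pattern).

HONEST LABEL: bookkeeping ∕ elementary real analysis; stubs B (assembly) ∕ core-tip ∕ core-end ∕ 001-good of skeleton ➎ OPEN, ⟨24197⟩ ∕ ⟨24194⟩ OPEN; own crux ⟨22884⟩
`LargeFieldMassRefinementTail` OPEN (blocked-on ⟨19935⟩); the Yang–Mills mass gap is NOT proved; no summit is proved by a line.  THEOREMS ONLY (0 `def`, 0 `sorry`),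
standard axioms; the series' local `ℍ` instances.  LEAD seat ym-line-sfw-p2 g99 (cell ym-idea-1, free hands), `--supports stmt-QuantumFields-24197`.  References: [folklore];
[cite: Luscher1983, §2].
-/

set_option autoImplicit false
set_option synthInstance.maxSize 1024

noncomputable section

open MeasureTheory Quaternion Set
open scoped Quaternion ENNReal BigOperators
open Literature.MathematicalPhysics.QuantumLattice
open Literature.MathematicalPhysics.QuantumFieldTheory hiding SU2
open Summit.QuantumFields.YangMills.Theorems.SwapTwistDeficit.ToronLog

attribute [local instance] Literature.Analysis.FluidPDE.Tao2016.quatMeasurableSpace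
  Literature.Analysis.FluidPDE.Tao2016.quatBorelSpace
  Literature.MathematicalPhysics.QuantumLattice.secondCountableTopology_su2

namespace Summit.QuantumFields.YangMills.Theorems.SwapVirialDeficit.BlowUpRing

open Summit.QuantumFields.YangMills.Theorems.FemtoTransferGap
open Summit.QuantumFields.YangMills.Theorems.FemtoTransferGap.TT
open Summit.QuantumFields.YangMills.Theorems.VirialFluxGap.RingDeficit
open Summit.QuantumFields.YangMills.Theorems.SwapVirialDeficit.SectorLaplace

variable {L : ℕ} [NeZero L]

/-! ## §1 The end window in the letter `δ` -/

/-- On the end window `4δ²/(1+δ²)² < τ ≤ (1+δ²)⁻¹`: `δ² < 1/3` (`4δ² < 1 + δ²`). [folklore] -/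
theorem endWindow_sq_lt_third {δ τ : ℝ} (h1 : 4 * δ ^ 2 / (1 + δ ^ 2) ^ 2 < τ) (h2 : τ ≤ (1 + δ ^ 2)⁻¹) : δ ^ 2 < 1 / 3 := by
  have hs : 0 < 1 + δ ^ 2 := by positivity
  have h : 4 * δ ^ 2 / (1 + δ ^ 2) ^ 2 < (1 + δ ^ 2)⁻¹ := lt_of_lt_of_le h1 h2
  have e : (1 + δ ^ 2)⁻¹ * (1 + δ ^ 2) ^ 2 = 1 + δ ^ 2 := by
    rw [sq (1 + δ ^ 2), ← mul_assoc, inv_mul_cancel₀ hs.ne', one_mul]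
  rw [div_lt_iff₀ (by positivity), e] at h
  nlinarith

/-- On the end window: `δ² < τ·(1+δ²)²/4`. [folklore] -/
theorem endWindow_sq_lt {δ τ : ℝ} (h1 : 4 * δ ^ 2 / (1 + δ ^ 2) ^ 2 < τ) : δ ^ 2 < τ * (1 + δ ^ 2) ^ 2 / 4 := by
  have hs : 0 < (1 + δ ^ 2) ^ 2 := by positivity
  rw [div_lt_iff₀ hs] at h1
  linarith

/-- On the end window: `δ² ≤ 4τ/9`. [folklore] -/
theorem endWindow_sq_le {δ τ : ℝ} (h1 : 4 * δ ^ 2 / (1 + δ ^ 2) ^ 2 < τ) (h2 : τ ≤ (1 + δ ^ 2)⁻¹) : δ ^ 2 ≤ 4 * τ / 9 := by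
  have h3 := endWindow_sq_lt_third h1 h2
  have h4 := endWindow_sq_lt h1
  have hτ : 0 ≤ τ := le_trans (by positivity) h1.le
  have h5 : (1 + δ ^ 2) ^ 2 ≤ 16 / 9 := by nlinarith [sq_nonneg δ]
  have h6 : τ * (1 + δ ^ 2) ^ 2 ≤ τ * (16 / 9) := mul_le_mul_of_nonneg_left h5 hτ
  linarith

/-- On the end window: `0 < τ ≤ 1`. [folklore] -/
theorem endWindow_tau_le_one {δ τ : ℝ} (h2 : τ ≤ (1 + δ ^ 2)⁻¹) : τ ≤ 1 :=
  h2.trans (inv_le_one_of_one_le₀ (by nlinarith [sq_nonneg δ]))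

/-! ## §2 The split `{end window} ∖ RgCap ⊆ G ∪ T` -/

omit [NeZero L] in
/-- ★ **THE THREE PARTS OF THE END CORE**: a point of `{end window} ∖ RgCap` lies either in the GAUSSIAN HALF `G = {end window} ∩ {|u|² ≤ 1 + x₀²}`
(part (i) `|u| < τ ≤ 1`, part (ii) the cap violated: `1 + |u|² ≤ X₁²(1+|u|²) < x₀²`, for `X₁ ≥ 1`) or in the HUB SHELL
`T = {end window ∧ τ√(1+δ²) ≤ |δ|} ∩ {τ ≤ |u|} ∩ {cap}` (part (iii)). [folklore] -/
theorem endCore_letters_subset {τ X₁ : ℝ} (hτ : 0 < τ) (hX : 1 ≤ X₁) :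
    {p : ℝ × GnoCoord L | 4 * p.1 ^ 2 / (1 + p.1 ^ 2) ^ 2 < τ ∧ τ ≤ (1 + p.1 ^ 2)⁻¹} \
        ({p : ℝ × GnoCoord L | 4 * p.1 ^ 2 / (1 + p.1 ^ 2) ^ 2 < τ ∧ τ ≤ (1 + p.1 ^ 2)⁻¹ ∧ |p.1| < τ * Real.sqrt (1 + p.1 ^ 2)} ∩
          {p : ℝ × GnoCoord L | τ ≤ Real.sqrt (p.2.1.1 1 ^ 2 + p.2.1.1 2 ^ 2)} ∩
          {p : ℝ × GnoCoord L | |p.2.1.1 0| ≤ X₁ * Real.sqrt (1 + p.2.1.1 1 ^ 2 + p.2.1.1 2 ^ 2)}) ⊆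
      ({p : ℝ × GnoCoord L | 4 * p.1 ^ 2 / (1 + p.1 ^ 2) ^ 2 < τ ∧ τ ≤ (1 + p.1 ^ 2)⁻¹} ∩
          {p : ℝ × GnoCoord L | p.2.1.1 1 ^ 2 + p.2.1.1 2 ^ 2 ≤ 1 + p.2.1.1 0 ^ 2}) ∪
        ({p : ℝ × GnoCoord L | (4 * p.1 ^ 2 / (1 + p.1 ^ 2) ^ 2 < τ ∧ τ ≤ (1 + p.1 ^ 2)⁻¹) ∧ τ * Real.sqrt (1 + p.1 ^ 2) ≤ |p.1|} ∩
          {p : ℝ × GnoCoord L | τ ≤ Real.sqrt (p.2.1.1 1 ^ 2 + p.2.1.1 2 ^ 2)} ∩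
          {p : ℝ × GnoCoord L | |p.2.1.1 0| ≤ X₁ * Real.sqrt (1 + p.2.1.1 1 ^ 2 + p.2.1.1 2 ^ 2)}) := by
  intro p hp
  obtain ⟨hW, hR⟩ := hp
  have hτ1 : τ ≤ 1 := endWindow_tau_le_one hW.2
  simp only [mem_inter_iff, mem_setOf_eq, mem_union]
  by_cases hu : τ ≤ Real.sqrt (p.2.1.1 1 ^ 2 + p.2.1.1 2 ^ 2)
  · by_cases hc : |p.2.1.1 0| ≤ X₁ * Real.sqrt (1 + p.2.1.1 1 ^ 2 + p.2.1.1 2 ^ 2)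
    · by_cases hd : |p.1| < τ * Real.sqrt (1 + p.1 ^ 2)
      · exact (hR ⟨⟨⟨hW.1, hW.2, hd⟩, hu⟩, hc⟩).elim
      · exact Or.inr ⟨⟨⟨hW, not_lt.1 hd⟩, hu⟩, hc⟩
    · -- part (ii): the cap is violated, `X₁²(1+|u|²) < x₀²`
      refine Or.inl ⟨hW, ?_⟩
      have h0 : 0 ≤ 1 + p.2.1.1 1 ^ 2 + p.2.1.1 2 ^ 2 := by positivity
      have hlt : X₁ * Real.sqrt (1 + p.2.1.1 1 ^ 2 + p.2.1.1 2 ^ 2) < |p.2.1.1 0| := not_le.1 hc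
      have hX0 : 0 ≤ X₁ * Real.sqrt (1 + p.2.1.1 1 ^ 2 + p.2.1.1 2 ^ 2) := mul_nonneg (by linarith) (Real.sqrt_nonneg _)
      have hsq : (X₁ * Real.sqrt (1 + p.2.1.1 1 ^ 2 + p.2.1.1 2 ^ 2)) ^ 2 < |p.2.1.1 0| ^ 2 := by
        exact pow_lt_pow_left₀ hlt hX0 two_ne_zero
      rw [mul_pow, Real.sq_sqrt h0, sq_abs] at hsq
      have hX2 : 1 ≤ X₁ ^ 2 := by nlinarith
      nlinarith [mul_le_mul_of_nonneg_right hX2 h0]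
  · -- part (i): `|u| < τ ≤ 1`
    refine Or.inl ⟨hW, ?_⟩
    have hlt : Real.sqrt (p.2.1.1 1 ^ 2 + p.2.1.1 2 ^ 2) < τ := not_le.1 hu
    have h' : p.2.1.1 1 ^ 2 + p.2.1.1 2 ^ 2 < τ ^ 2 := (Real.sqrt_lt' hτ).1 hlt
    have hτ2 : τ ^ 2 ≤ 1 := pow_le_one₀ hτ.le hτ1
    nlinarith [sq_nonneg (p.2.1.1 0)]

omit [NeZero L] in
/-- The Gaussian half `G = {end window} ∩ {|u|² ≤ 1 + x₀²}` is measurable. [folklore] -/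
theorem measurableSet_endGaussHalf (τ : ℝ) :
    MeasurableSet ({p : ℝ × GnoCoord L | 4 * p.1 ^ 2 / (1 + p.1 ^ 2) ^ 2 < τ ∧ τ ≤ (1 + p.1 ^ 2)⁻¹} ∩
      {p : ℝ × GnoCoord L | p.2.1.1 1 ^ 2 + p.2.1.1 2 ^ 2 ≤ 1 + p.2.1.1 0 ^ 2}) := by
  have hx : ∀ i : Fin 3, Measurable fun p : ℝ × GnoCoord L => p.2.1.1 i :=
    fun i => (measurable_pi_apply i).comp (measurable_fst.comp (measurable_fst.comp measurable_snd))
  exact (measurableSet_endWindow τ).inter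
    (measurableSet_le (((hx 1).pow_const 2).add ((hx 2).pow_const 2)) (measurable_const.add ((hx 0).pow_const 2)))

omit [NeZero L] in
/-- The hub shell `T = {end window ∧ τ√(1+δ²) ≤ |δ|} ∩ {τ ≤ |u|} ∩ {cap}` is measurable. [folklore] -/
theorem measurableSet_endHubShell (τ X₁ : ℝ) :
    MeasurableSet ({p : ℝ × GnoCoord L | (4 * p.1 ^ 2 / (1 + p.1 ^ 2) ^ 2 < τ ∧ τ ≤ (1 + p.1 ^ 2)⁻¹) ∧ τ * Real.sqrt (1 + p.1 ^ 2) ≤ |p.1|} ∩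
          {p : ℝ × GnoCoord L | τ ≤ Real.sqrt (p.2.1.1 1 ^ 2 + p.2.1.1 2 ^ 2)} ∩
          {p : ℝ × GnoCoord L | |p.2.1.1 0| ≤ X₁ * Real.sqrt (1 + p.2.1.1 1 ^ 2 + p.2.1.1 2 ^ 2)}) := by
  have hx : ∀ i : Fin 3, Measurable fun p : ℝ × GnoCoord L => p.2.1.1 i :=
    fun i => (measurable_pi_apply i).comp (measurable_fst.comp (measurable_fst.comp measurable_snd))
  have h1 : Measurable fun p : ℝ × GnoCoord L => p.1 := measurable_fst
  refine (MeasurableSet.inter ?_ (measurableSet_le measurable_const (((hx 1).pow_const 2).add ((hx 2).pow_const 2)).sqrt)).inter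
    (measurableSet_le (hx 0).abs (measurable_const.mul ((measurable_const.add ((hx 1).pow_const 2)).add ((hx 2).pow_const 2)).sqrt))
  exact (measurableSet_endWindow τ).inter (measurableSet_le (measurable_const.mul (measurable_const.add (h1.pow_const 2)).sqrt) h1.abs)

/-! ## §3 The constant floor on the hub shell (part (iii)) -/

/-- ★ **THE HUB-SHELL FLOOR**: on `T` (end window, `τ√(1+δ²) ≤ |δ|`, `τ ≤ |u|`, cap `|x₀| ≤ X₁√(1+|u|²)`), for EVERY sign pattern `ε`,
`τ⁴/((1+τ²)(1+X₁²)²·15000(1+|Fol L|)L⁶) ≤ F̂(hubAt δ 1, ε, η)` (✓`bTubeCap_letter_floor` with `δ² ≥ τ²(1+δ²) ≥ τ²`, `δ² < 1/3`). [cite: Luscher1983, §2] -/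
theorem endCore_partIII_floor {δ τ X₁ : ℝ} (hτ : 0 < τ) (h1 : 4 * δ ^ 2 / (1 + δ ^ 2) ^ 2 < τ) (h2 : τ ≤ (1 + δ ^ 2)⁻¹)
    (hd : τ * Real.sqrt (1 + δ ^ 2) ≤ |δ|) (ε : GnoSign L) (η : GnoCoord L) (hu : τ ≤ Real.sqrt (η.1.1 1 ^ 2 + η.1.1 2 ^ 2))
    (hx0 : |η.1.1 0| ≤ X₁ * Real.sqrt (1 + η.1.1 1 ^ 2 + η.1.1 2 ^ 2)) :
    τ ^ 4 / ((1 + τ ^ 2) * (1 + X₁ ^ 2) ^ 2 * (15000 * (1 + (Fintype.card (Fol L) : ℝ)) * (L : ℝ) ^ 6)) ≤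
      gnoDeficit z₀ (fun _ => 1) (hubAt δ 1) ε η := by
  have hL : (0 : ℝ) < L := by exact_mod_cast NeZero.pos L
  have hδ1 : δ ^ 2 ≤ 1 := by linarith [endWindow_sq_lt_third h1 h2]
  have hu0 : 0 ≤ η.1.1 1 ^ 2 + η.1.1 2 ^ 2 := by positivity
  have hu' : τ ^ 2 ≤ η.1.1 1 ^ 2 + η.1.1 2 ^ 2 := (Real.le_sqrt hτ.le hu0).1 hu
  have h0 : 0 ≤ 1 + η.1.1 1 ^ 2 + η.1.1 2 ^ 2 := by positivity
  have hx0' : η.1.1 0 ^ 2 ≤ X₁ ^ 2 * (1 + (η.1.1 1 ^ 2 + η.1.1 2 ^ 2)) := by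
    have h := pow_le_pow_left₀ (abs_nonneg _) hx0 2
    rw [sq_abs, mul_pow, Real.sq_sqrt h0] at h
    linarith
  have hδτ : τ ^ 2 ≤ δ ^ 2 := by
    have hs0 : 0 ≤ τ * Real.sqrt (1 + δ ^ 2) := mul_nonneg hτ.le (Real.sqrt_nonneg _)
    have h := pow_le_pow_left₀ hs0 hd 2
    rw [sq_abs, mul_pow, Real.sq_sqrt (by positivity)] at h
    nlinarith [sq_nonneg τ, sq_nonneg δ]
  have hfl := bTubeCap_letter_floor δ τ X₁ hτ hδ1 ε η hu' hx0'
  have hK : 0 < 15000 * (1 + (Fintype.card (Fol L) : ℝ)) * (L : ℝ) ^ 6 := by positivity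
  have hθ : 0 ≤ τ ^ 2 / ((1 + τ ^ 2) * (1 + X₁ ^ 2) ^ 2) := by positivity
  have hA : 0 ≤ η.1.1 0 ^ 2 / (1 + (η.1.1 1 ^ 2 + η.1.1 2 ^ 2)) := by positivity
  have hB : 0 ≤ min (η.1.2 0 ^ 2 + η.1.2 1 ^ 2 + η.1.2 2 ^ 2) 1 := le_min (by positivity) zero_le_one
  have hC : 0 ≤ min (η.2.1 0 ^ 2 + η.2.1 1 ^ 2 + η.2.1 2 ^ 2) 1 := le_min (by positivity) zero_le_one
  have hD : 0 ≤ min (∑ i : Fol L, (η.2.2 i 0 ^ 2 + η.2.2 i 1 ^ 2 + η.2.2 i 2 ^ 2)) 1 :=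
    le_min (Finset.sum_nonneg fun i _ => by positivity) zero_le_one
  have hmain : τ ^ 2 / ((1 + τ ^ 2) * (1 + X₁ ^ 2) ^ 2) * τ ^ 2 ≤
      15000 * (1 + (Fintype.card (Fol L) : ℝ)) * (L : ℝ) ^ 6 * gnoDeficit z₀ (fun _ => 1) (hubAt δ 1) ε η := by
    refine le_trans ?_ hfl
    have h := mul_le_mul_of_nonneg_left (show τ ^ 2 ≤ δ ^ 2 + η.1.1 0 ^ 2 / (1 + (η.1.1 1 ^ 2 + η.1.1 2 ^ 2)) +
        min (η.1.2 0 ^ 2 + η.1.2 1 ^ 2 + η.1.2 2 ^ 2) 1 + min (η.2.1 0 ^ 2 + η.2.1 1 ^ 2 + η.2.1 2 ^ 2) 1 +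
        min (∑ i : Fol L, (η.2.2 i 0 ^ 2 + η.2.2 i 1 ^ 2 + η.2.2 i 2 ^ 2)) 1 by linarith) hθ
    exact h
  have e : τ ^ 4 / ((1 + τ ^ 2) * (1 + X₁ ^ 2) ^ 2 * (15000 * (1 + (Fintype.card (Fol L) : ℝ)) * (L : ℝ) ^ 6)) =
      τ ^ 2 / ((1 + τ ^ 2) * (1 + X₁ ^ 2) ^ 2) * τ ^ 2 / (15000 * (1 + (Fintype.card (Fol L) : ℝ)) * (L : ℝ) ^ 6) := by
    rw [div_mul_eq_mul_div, div_div]; ring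
  rw [e, div_le_iff₀ hK]
  linarith

/-! ## §4 The total mass of `μ_B` -/

/-- `μ_B(univ) ≤ π · ∫ρ` (`(1+δ²)⁻² ≤ (1+δ²)⁻¹`, `∫(1+δ²)⁻¹ = π`). [folklore] -/
theorem muB_univ_le :
    ((volume : Measure (ℝ × GnoCoord L)).withDensity (fun p => ENNReal.ofReal (((1 + p.1 ^ 2)⁻¹) ^ 2 * gnoDensity p.2))) univ ≤
      ENNReal.ofReal (Real.pi * ∫ η : GnoCoord L, gnoDensity η) := by
  rw [withDensity_apply _ MeasurableSet.univ, Measure.restrict_univ]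
  have hpt : ∀ p : ℝ × GnoCoord L, ENNReal.ofReal (((1 + p.1 ^ 2)⁻¹) ^ 2 * gnoDensity p.2) ≤
      ENNReal.ofReal ((1 + p.1 ^ 2)⁻¹) * ENNReal.ofReal (gnoDensity p.2) := by
    intro p
    have h0 : 0 ≤ (1 + p.1 ^ 2)⁻¹ := by positivity
    have h1 : (1 + p.1 ^ 2)⁻¹ ≤ 1 := inv_le_one_of_one_le₀ (by nlinarith [sq_nonneg p.1])
    rw [← ENNReal.ofReal_mul h0]
    refine ENNReal.ofReal_le_ofReal ?_
    have hρ := (gnoDensity_pos p.2).le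
    nlinarith [mul_nonneg h0 hρ, mul_le_mul_of_nonneg_right h1 (mul_nonneg h0 hρ)]
  have hm1 : Measurable fun δ : ℝ => ENNReal.ofReal ((1 + δ ^ 2)⁻¹) := (measurable_const.add (measurable_id.pow_const 2)).inv.ennreal_ofReal
  have hm2 : Measurable fun η : GnoCoord L => ENNReal.ofReal (gnoDensity η) := measurable_gnoDensity.ennreal_ofReal
  calc ∫⁻ p : ℝ × GnoCoord L, ENNReal.ofReal (((1 + p.1 ^ 2)⁻¹) ^ 2 * gnoDensity p.2)
      ≤ ∫⁻ p : ℝ × GnoCoord L, ENNReal.ofReal ((1 + p.1 ^ 2)⁻¹) * ENNReal.ofReal (gnoDensity p.2) := lintegral_mono hpt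
    _ = (∫⁻ δ : ℝ, ENNReal.ofReal ((1 + δ ^ 2)⁻¹)) * ∫⁻ η : GnoCoord L, ENNReal.ofReal (gnoDensity η) := by
        rw [Measure.volume_eq_prod]; exact lintegral_prod_mul hm1.aemeasurable hm2.aemeasurable
    _ = ENNReal.ofReal Real.pi * ENNReal.ofReal (∫ η : GnoCoord L, gnoDensity η) := by
        rw [← ofReal_integral_eq_lintegral_ofReal integrable_inv_one_add_sq (Filter.Eventually.of_forall fun δ => by positivity),
          integral_univ_inv_one_add_sq,
          ← ofReal_integral_eq_lintegral_ofReal integrable_gnoDensity (Filter.Eventually.of_forall fun η => (gnoDensity_pos η).le)]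
    _ = ENNReal.ofReal (Real.pi * ∫ η : GnoCoord L, gnoDensity η) := (ENNReal.ofReal_mul Real.pi_pos.le).symm

/-- ★ `μ_B(univ) ≤ π · e^{|log(coneConst³/64)| + 18L⁴}` (✓`totalMass_le_exp`). [folklore] -/
theorem muB_univ_le_exp :
    ((volume : Measure (ℝ × GnoCoord L)).withDensity (fun p => ENNReal.ofReal (((1 + p.1 ^ 2)⁻¹) ^ 2 * gnoDensity p.2))) univ ≤
      ENNReal.ofReal (Real.pi * Real.exp (|Real.log (coneConst ^ 3 / 64)| + 18 * (L : ℝ) ^ 4)) :=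
  muB_univ_le.trans (ENNReal.ofReal_le_ofReal (mul_le_mul_of_nonneg_left totalMass_le_exp Real.pi_pos.le))

/-! ## §5 The end core ≤ Gaussian half + threshold tail -/

/-- ★ **THE HUB-SHELL TAIL**: for `b ≥ 0` and any cap `X₁`,
`∫⁻_T ofReal(e^{−bF̂(hubAt δ 1, ε, η)}) dμ_B ≤ ofReal(e^{−b·c_end} · π · e^{|log(coneConst³/64)| + 18L⁴})`. [folklore] -/
theorem lintegral_endHubShell_le (ε : GnoSign L) {τ b : ℝ} (X₁ : ℝ) (hτ : 0 < τ) (hb : 0 ≤ b) :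
    ∫⁻ p in {p : ℝ × GnoCoord L | (4 * p.1 ^ 2 / (1 + p.1 ^ 2) ^ 2 < τ ∧ τ ≤ (1 + p.1 ^ 2)⁻¹) ∧ τ * Real.sqrt (1 + p.1 ^ 2) ≤ |p.1|} ∩
          {p : ℝ × GnoCoord L | τ ≤ Real.sqrt (p.2.1.1 1 ^ 2 + p.2.1.1 2 ^ 2)} ∩
          {p : ℝ × GnoCoord L | |p.2.1.1 0| ≤ X₁ * Real.sqrt (1 + p.2.1.1 1 ^ 2 + p.2.1.1 2 ^ 2)},
        ENNReal.ofReal (Real.exp (-(b * gnoDeficit z₀ (fun _ => 1) (hubAt p.1 1) ε p.2)))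
        ∂((volume : Measure (ℝ × GnoCoord L)).withDensity fun p => ENNReal.ofReal (((1 + p.1 ^ 2)⁻¹) ^ 2 * gnoDensity p.2)) ≤
      ENNReal.ofReal (Real.exp (-(b * (τ ^ 4 / ((1 + τ ^ 2) * (1 + X₁ ^ 2) ^ 2 * (15000 * (1 + (Fintype.card (Fol L) : ℝ)) * (L : ℝ) ^ 6))))) *
        (Real.pi * Real.exp (|Real.log (coneConst ^ 3 / 64)| + 18 * (L : ℝ) ^ 4))) := by
  set μB := (volume : Measure (ℝ × GnoCoord L)).withDensity fun p => ENNReal.ofReal (((1 + p.1 ^ 2)⁻¹) ^ 2 * gnoDensity p.2) with hμB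
  set c : ℝ := τ ^ 4 / ((1 + τ ^ 2) * (1 + X₁ ^ 2) ^ 2 * (15000 * (1 + (Fintype.card (Fol L) : ℝ)) * (L : ℝ) ^ 6)) with hc
  set T : Set (ℝ × GnoCoord L) :=
    {p : ℝ × GnoCoord L | (4 * p.1 ^ 2 / (1 + p.1 ^ 2) ^ 2 < τ ∧ τ ≤ (1 + p.1 ^ 2)⁻¹) ∧ τ * Real.sqrt (1 + p.1 ^ 2) ≤ |p.1|} ∩
      {p : ℝ × GnoCoord L | τ ≤ Real.sqrt (p.2.1.1 1 ^ 2 + p.2.1.1 2 ^ 2)} ∩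
      {p : ℝ × GnoCoord L | |p.2.1.1 0| ≤ X₁ * Real.sqrt (1 + p.2.1.1 1 ^ 2 + p.2.1.1 2 ^ 2)} with hT
  have hTm : MeasurableSet T := measurableSet_endHubShell τ X₁
  have hpt : ∀ p ∈ T, ENNReal.ofReal (Real.exp (-(b * gnoDeficit z₀ (fun _ => 1) (hubAt p.1 1) ε p.2))) ≤ ENNReal.ofReal (Real.exp (-(b * c))) := by
    intro p hp
    obtain ⟨⟨⟨⟨h1, h2⟩, hd⟩, hu⟩, hx0⟩ := hp
    have hfl := endCore_partIII_floor hτ h1 h2 hd ε p.2 hu hx0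
    exact ENNReal.ofReal_le_ofReal (Real.exp_le_exp.2 (neg_le_neg (mul_le_mul_of_nonneg_left hfl hb)))
  calc ∫⁻ p in T, ENNReal.ofReal (Real.exp (-(b * gnoDeficit z₀ (fun _ => 1) (hubAt p.1 1) ε p.2))) ∂μB
      ≤ ∫⁻ p in T, ENNReal.ofReal (Real.exp (-(b * c))) ∂μB := setLIntegral_mono' hTm hpt
    _ = ENNReal.ofReal (Real.exp (-(b * c))) * μB T := setLIntegral_const T _
    _ ≤ ENNReal.ofReal (Real.exp (-(b * c))) * ENNReal.ofReal (Real.pi * Real.exp (|Real.log (coneConst ^ 3 / 64)| + 18 * (L : ℝ) ^ 4)) :=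
        mul_le_mul' le_rfl ((measure_mono (subset_univ T)).trans muB_univ_le_exp)
    _ = _ := (ENNReal.ofReal_mul (Real.exp_pos _).le).symm

/-- ★★ **THE END CORE ≤ GAUSSIAN HALF + TAIL** (letters, `ℝ≥0∞` form): for `0 < τ`, `1 ≤ X₁`, `0 ≤ b`,
`∫⁻_{{end window}∖RgCap} ofReal(e^{−bF̂}) dμ_B ≤ ∫⁻_G ofReal(e^{−bF̂}) dμ_B + ofReal(e^{−b·c_end}·π·e^{|log(coneConst³/64)|+18L⁴})`. [folklore] -/
theorem lintegral_endCore_le_gaussHalf_add_tail (ε : GnoSign L) {τ X₁ b : ℝ} (hτ : 0 < τ) (hX : 1 ≤ X₁) (hb : 0 ≤ b) :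
    ∫⁻ p in {p : ℝ × GnoCoord L | 4 * p.1 ^ 2 / (1 + p.1 ^ 2) ^ 2 < τ ∧ τ ≤ (1 + p.1 ^ 2)⁻¹} \
            ({p : ℝ × GnoCoord L | 4 * p.1 ^ 2 / (1 + p.1 ^ 2) ^ 2 < τ ∧ τ ≤ (1 + p.1 ^ 2)⁻¹ ∧ |p.1| < τ * Real.sqrt (1 + p.1 ^ 2)} ∩
              {p : ℝ × GnoCoord L | τ ≤ Real.sqrt (p.2.1.1 1 ^ 2 + p.2.1.1 2 ^ 2)} ∩
              {p : ℝ × GnoCoord L | |p.2.1.1 0| ≤ X₁ * Real.sqrt (1 + p.2.1.1 1 ^ 2 + p.2.1.1 2 ^ 2)}),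
          ENNReal.ofReal (Real.exp (-(b * gnoDeficit z₀ (fun _ => 1) (hubAt p.1 1) ε p.2)))
          ∂((volume : Measure (ℝ × GnoCoord L)).withDensity fun p => ENNReal.ofReal (((1 + p.1 ^ 2)⁻¹) ^ 2 * gnoDensity p.2)) ≤
      (∫⁻ p in {p : ℝ × GnoCoord L | 4 * p.1 ^ 2 / (1 + p.1 ^ 2) ^ 2 < τ ∧ τ ≤ (1 + p.1 ^ 2)⁻¹} ∩
            {p : ℝ × GnoCoord L | p.2.1.1 1 ^ 2 + p.2.1.1 2 ^ 2 ≤ 1 + p.2.1.1 0 ^ 2},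
          ENNReal.ofReal (Real.exp (-(b * gnoDeficit z₀ (fun _ => 1) (hubAt p.1 1) ε p.2)))
          ∂((volume : Measure (ℝ × GnoCoord L)).withDensity fun p => ENNReal.ofReal (((1 + p.1 ^ 2)⁻¹) ^ 2 * gnoDensity p.2))) +
        ENNReal.ofReal (Real.exp (-(b * (τ ^ 4 / ((1 + τ ^ 2) * (1 + X₁ ^ 2) ^ 2 * (15000 * (1 + (Fintype.card (Fol L) : ℝ)) * (L : ℝ) ^ 6))))) *
          (Real.pi * Real.exp (|Real.log (coneConst ^ 3 / 64)| + 18 * (L : ℝ) ^ 4))) := by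
  have hsub := endCore_letters_subset (L := L) hτ hX
  refine (lintegral_mono_set hsub).trans ((lintegral_union_le _ _ _).trans ?_)
  exact add_le_add le_rfl (lintegral_endHubShell_le ε X₁ hτ hb)

/-- ★★ **THE END CORE ≤ GAUSSIAN HALF + TAIL** (letters, Bochner form): for `0 < τ`, `1 ≤ X₁`, `0 ≤ b`,
`∫_{{end window}∖RgCap} e^{−bF̂} dμ_B ≤ ∫_G e^{−bF̂} dμ_B + e^{−b·c_end}·π·e^{|log(coneConst³/64)|+18L⁴}`. [folklore] -/
theorem setIntegral_endCore_le_gaussHalf_add_tail (ε : GnoSign L) {τ X₁ b : ℝ} (hτ : 0 < τ) (hX : 1 ≤ X₁) (hb : 0 ≤ b) :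
    ∫ p in {p : ℝ × GnoCoord L | 4 * p.1 ^ 2 / (1 + p.1 ^ 2) ^ 2 < τ ∧ τ ≤ (1 + p.1 ^ 2)⁻¹} \
            ({p : ℝ × GnoCoord L | 4 * p.1 ^ 2 / (1 + p.1 ^ 2) ^ 2 < τ ∧ τ ≤ (1 + p.1 ^ 2)⁻¹ ∧ |p.1| < τ * Real.sqrt (1 + p.1 ^ 2)} ∩
              {p : ℝ × GnoCoord L | τ ≤ Real.sqrt (p.2.1.1 1 ^ 2 + p.2.1.1 2 ^ 2)} ∩
              {p : ℝ × GnoCoord L | |p.2.1.1 0| ≤ X₁ * Real.sqrt (1 + p.2.1.1 1 ^ 2 + p.2.1.1 2 ^ 2)}),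
          Real.exp (-(b * gnoDeficit z₀ (fun _ => 1) (hubAt p.1 1) ε p.2))
          ∂((volume : Measure (ℝ × GnoCoord L)).withDensity fun p => ENNReal.ofReal (((1 + p.1 ^ 2)⁻¹) ^ 2 * gnoDensity p.2)) ≤
      (∫ p in {p : ℝ × GnoCoord L | 4 * p.1 ^ 2 / (1 + p.1 ^ 2) ^ 2 < τ ∧ τ ≤ (1 + p.1 ^ 2)⁻¹} ∩
            {p : ℝ × GnoCoord L | p.2.1.1 1 ^ 2 + p.2.1.1 2 ^ 2 ≤ 1 + p.2.1.1 0 ^ 2},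
          Real.exp (-(b * gnoDeficit z₀ (fun _ => 1) (hubAt p.1 1) ε p.2))
          ∂((volume : Measure (ℝ × GnoCoord L)).withDensity fun p => ENNReal.ofReal (((1 + p.1 ^ 2)⁻¹) ^ 2 * gnoDensity p.2))) +
        Real.exp (-(b * (τ ^ 4 / ((1 + τ ^ 2) * (1 + X₁ ^ 2) ^ 2 * (15000 * (1 + (Fintype.card (Fol L) : ℝ)) * (L : ℝ) ^ 6))))) *
          (Real.pi * Real.exp (|Real.log (coneConst ^ 3 / 64)| + 18 * (L : ℝ) ^ 4)) := by
  set μB := (volume : Measure (ℝ × GnoCoord L)).withDensity fun p => ENNReal.ofReal (((1 + p.1 ^ 2)⁻¹) ^ 2 * gnoDensity p.2) with hμB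
  haveI : IsFiniteMeasure μB := isFiniteMeasure_muB
  set f : ℝ × GnoCoord L → ℝ := fun p => Real.exp (-(b * gnoDeficit z₀ (fun _ => 1) (hubAt p.1 1) ε p.2)) with hf
  have hfm : Measurable f := ((measurable_bDeficit z₀ (fun _ => 1) ε).const_mul b).neg.exp
  have hf0 : ∀ p, 0 ≤ f p := fun p => (Real.exp_pos _).le
  have hf1 : ∀ p, f p ≤ 1 := fun p => by
    show Real.exp _ ≤ 1
    rw [Real.exp_le_one_iff, neg_nonpos]
    exact mul_nonneg hb (gnoDeficit_nonneg _ _ _ _ _)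
  -- `f` is integrable on every set against the finite measure `μ_B`
  have hfi : ∀ S : Set (ℝ × GnoCoord L), IntegrableOn f S μB := fun S =>
    ((integrable_const (1 : ℝ)).mono' hfm.aestronglyMeasurable
      (Filter.Eventually.of_forall fun p => by rw [Real.norm_eq_abs, abs_of_nonneg (hf0 p)]; exact hf1 p)).integrableOn
  set EW : Set (ℝ × GnoCoord L) := {p : ℝ × GnoCoord L | 4 * p.1 ^ 2 / (1 + p.1 ^ 2) ^ 2 < τ ∧ τ ≤ (1 + p.1 ^ 2)⁻¹} with hEW
  set RC : Set (ℝ × GnoCoord L) :=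
    {p : ℝ × GnoCoord L | 4 * p.1 ^ 2 / (1 + p.1 ^ 2) ^ 2 < τ ∧ τ ≤ (1 + p.1 ^ 2)⁻¹ ∧ |p.1| < τ * Real.sqrt (1 + p.1 ^ 2)} ∩
      {p : ℝ × GnoCoord L | τ ≤ Real.sqrt (p.2.1.1 1 ^ 2 + p.2.1.1 2 ^ 2)} ∩
      {p : ℝ × GnoCoord L | |p.2.1.1 0| ≤ X₁ * Real.sqrt (1 + p.2.1.1 1 ^ 2 + p.2.1.1 2 ^ 2)} with hRC
  set G : Set (ℝ × GnoCoord L) := EW ∩ {p : ℝ × GnoCoord L | p.2.1.1 1 ^ 2 + p.2.1.1 2 ^ 2 ≤ 1 + p.2.1.1 0 ^ 2} with hG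
  set K : ℝ := Real.exp (-(b * (τ ^ 4 / ((1 + τ ^ 2) * (1 + X₁ ^ 2) ^ 2 * (15000 * (1 + (Fintype.card (Fol L) : ℝ)) * (L : ℝ) ^ 6))))) *
    (Real.pi * Real.exp (|Real.log (coneConst ^ 3 / 64)| + 18 * (L : ℝ) ^ 4)) with hK
  have hK0 : 0 ≤ K := by positivity
  have h := lintegral_endCore_le_gaussHalf_add_tail ε hτ hX hb
  rw [← hμB] at h
  -- convert the three `lintegral`s to Bochner integrals
  have e1 : ∫⁻ p in EW \ RC, ENNReal.ofReal (f p) ∂μB = ENNReal.ofReal (∫ p in EW \ RC, f p ∂μB) :=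
    (ofReal_integral_eq_lintegral_ofReal (hfi _) (Filter.Eventually.of_forall hf0)).symm
  have e2 : ∫⁻ p in G, ENNReal.ofReal (f p) ∂μB = ENNReal.ofReal (∫ p in G, f p ∂μB) :=
    (ofReal_integral_eq_lintegral_ofReal (hfi _) (Filter.Eventually.of_forall hf0)).symm
  have h' : ENNReal.ofReal (∫ p in EW \ RC, f p ∂μB) ≤ ENNReal.ofReal (∫ p in G, f p ∂μB) + ENNReal.ofReal K := by
    have h'' := h
    simp only [] at h''
    rw [e1, e2] at h''
    exact h''
  rw [← ENNReal.ofReal_add (setIntegral_nonneg (measurableSet_endGaussHalf τ) fun p _ => hf0 p) hK0] at h'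
  exact (ENNReal.ofReal_le_ofReal_iff (add_nonneg (setIntegral_nonneg (measurableSet_endGaussHalf τ) fun p _ => hf0 p) hK0)).1 h'

/-- ★★ **THE END CORE OF SKELETON ➎ ≤ GAUSSIAN HALF + TAIL, READ ON `chartMeasure L`**: for `0 < τ`, `0 ≤ b` and every sign pattern `ε`,
`∫_{(EndHub τ ×ˢ univ) ∖ BTubeCap L τ 1} e^{−bF̂_ε} d(chartMeasure) ≤ coneConst·π·(∫_G e^{−bF̂(hubAt δ 1, ε, η)} dμ_B + e^{−b·c_end(τ,1)}·π·e^{|log(coneConst³/64)|+18L⁴})`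
with `G = {end window} ∩ {|u|² ≤ 1 + x₀²}` and `c_end(τ,1) = τ⁴/((1+τ²)·4·15000(1+|Fol L|)L⁶)`. [folklore] -/
theorem setIntegral_endCore_chart_le_gaussHalf_add_tail (ε : GnoSign L) {τ b : ℝ} (hτ : 0 < τ) (hb : 0 ≤ b) :
    ∫ x in (EndHub τ ×ˢ (univ : Set (GnoCoord L))) \ BTubeCap L τ 1, Real.exp (-(b * gnoDeficit z₀ (fun _ => 1) x.1 ε x.2)) ∂(chartMeasure L) ≤
      coneConst * Real.pi *
        ((∫ p in {p : ℝ × GnoCoord L | 4 * p.1 ^ 2 / (1 + p.1 ^ 2) ^ 2 < τ ∧ τ ≤ (1 + p.1 ^ 2)⁻¹} ∩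
              {p : ℝ × GnoCoord L | p.2.1.1 1 ^ 2 + p.2.1.1 2 ^ 2 ≤ 1 + p.2.1.1 0 ^ 2},
            Real.exp (-(b * gnoDeficit z₀ (fun _ => 1) (hubAt p.1 1) ε p.2))
            ∂((volume : Measure (ℝ × GnoCoord L)).withDensity fun p => ENNReal.ofReal (((1 + p.1 ^ 2)⁻¹) ^ 2 * gnoDensity p.2))) +
          Real.exp (-(b * (τ ^ 4 / ((1 + τ ^ 2) * (1 + (1 : ℝ) ^ 2) ^ 2 * (15000 * (1 + (Fintype.card (Fol L) : ℝ)) * (L : ℝ) ^ 6))))) *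
            (Real.pi * Real.exp (|Real.log (coneConst ^ 3 / 64)| + 18 * (L : ℝ) ^ 4))) := by
  rw [setIntegral_endCore_exp_eq_hubCot z₀ (fun _ => 1) ε τ 1 b]
  exact mul_le_mul_of_nonneg_left (setIntegral_endCore_le_gaussHalf_add_tail ε hτ le_rfl hb) (mul_pos coneConst_pos Real.pi_pos).le

end Summit.QuantumFields.YangMills.Theorems.SwapVirialDeficit.BlowUpRing

end
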